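import Literature.MathematicalPhysics.QuantumFieldTheory.OSLaplaceRaw
import Literature.MathematicalPhysics.QuantumFieldTheory.OSDistributionSpace
import Literature.MathematicalPhysics.QuantumLattice.SchwingerWightmanBoundaryValueProofs
import Literature.MathematicalPhysics.QuantumLattice.SchwartzTranslationCutoff
import Literature.Analysis.FunctionSpaces.SchwartzParametric
import HarnessLib

/-!
# The Schwinger functions and the OS inner product in momentum space

Topic `Literature/MathematicalPhysics/QuantumFieldTheory`; third file towards `OS1973_wightmanVectors`
(Osterwalder–Schrader I (1973), §4.3). For an OS continuation family `𝒲` of a Schwinger family `S`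
whose Fourier transforms are supported in the spectral sets (the conclusion of
`OS1975_exists_continuation_halfSpace` upgraded by Lorentz invariance, `WightmanProofs`), this file
establishes the momentum-space form of the Schwinger functions and of the OS inner product used in
OS I (4.22)–(4.25):

* `momentumDual T` — the momentum-space distribution `ũ = T ∘ 𝓕⁻¹` of an `n`-point distribution
  `T` (OS's `W̃ₙ`, through the flattening `(ℝ^{1+d})ⁿ ≃ ℝ^{n(1+d)}` on which Mathlib's Fourier
  transform lives), with `T F = ũ(𝓕 F)` and the **support property**
  `momentumDual_eq_of_eqOn`: `ũ Φ₁ = ũ Φ₂` when `Φ₁ = Φ₂` near the spectral set;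
* `eqOn_fourierLaplaceFun` — **the OS continuation is the Fourier–Laplace transform of `ũ`** on
  the forward tube (explicit form of Streater–Wightman Thm. 3-5 / OS I (4.12): uniqueness of
  distributional boundary values, `eq_zero_of_distributionalBoundaryValue_zero_holds`);
* `apply_eq_momentumDual_laplaceTestS` — **the Schwinger function of a time-ordered test function
  is `ũ` of its Laplace transform**, `𝔖ₙ(F) = ũₙ(F̃)` (OS I (4.12) integrated against `F`,
  (4.20)–(4.21): `∫ 𝔚ₙ(ιx) F(x) dx = ∫ ũ(K_{ιx}) F(x) dx = ũ(∫ F(x) K_{ιx} dx)` by the exchange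
  `clm_laplaceTest`);
* `momentumDual_smulLeft_totalMomentum` — **translation invariance in momentum space**:
  `ũ((γ ∘ P) Φ) = γ(0) ũ(Φ)` for every Schwartz `γ` on `ℝ^{1+d}`, `P ξ = ∑ₖ ξₖ` the total momentum
  (Fourier expansion of `γ`, translation invariance `ũ(e^{−2πi⟪ã,·⟫} Φ) = ũ(Φ)` and the exchange
  theorem of `SchwartzExchange`); hence the Euclidean formula for test functions with increasing
  times of any sign (`apply_eq_momentumDual_laplaceTestS_of_monoRegion`: shift to positive times
  by E1, which multiplies the Laplace transform by `e^{2πt P⁰}`, a Schwartz multiplier on the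
  support of the cutoff);
* `osPairing_eq_momentumDual` and `osPairing_eq_momentumDual_blocks` — **the OS inner product in
  momentum space** (OS I (4.22)–(4.24)): `𝔖ₙ₊ₘ(Θf* ⊗ g) = ũₙ₊ₘ(χ_S · (f̄̃ₙ⁻ ⊠ g̃ₘ))` with
  `f̄̃⁻(ξ) = conj f̃(−ξ_{n−1}, …, −ξ₀)` (`starNegRev`) and `g̃` the Laplace test functions relative to
  the OS momentum sets.

## References

* K. Osterwalder, R. Schrader, *Axioms for Euclidean Green's functions*, Comm. Math. Phys. 31
  (1973) 83–112, §4.1 (4.12)–(4.13), §4.3 (4.20)–(4.25). [OsterwalderSchraderCMP1973]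
* R. F. Streater, A. S. Wightman, *PCT, Spin and Statistics, and All That* (1964), Thm. 2-17,
  Thm. 3-5. [StreaterWightman1964]
-/

noncomputable section

open Set Filter Complex MeasureTheory SchwartzMap
open _root_.Topology
open scoped SchwartzMap RealInnerProductSpace ComplexConjugate ContDiff FourierTransform
open Literature.MathematicalPhysics.QuantumLattice Literature.MathematicalPhysics.QuantumFieldTheory
open Literature.Analysis.FunctionSpaces Literature.Analysis.Distribution

namespace Literature.MathematicalPhysics.QuantumFieldTheory

variable {d n m : ℕ}

/-! ### The momentum-space distribution -/

variable (d n) in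
/-- The un-flattening of test functions `𝓢(ℝ^{n(1+d)}) → 𝓢((ℝ^{1+d})ⁿ)`, inverse to
`flattenTest`. [folklore] -/
abbrev unflattenCLM : 𝓢(EuclideanSpace ℝ (Fin n × Fin (d + 1)), ℂ) →L[ℂ] 𝓢((Fin n → SpaceTime d), ℂ) :=
  SchwartzMap.compCLMOfContinuousLinearEquiv ℂ (flattenCLE d n)

/-- `unflattenCLM ψ ξ = ψ (flatten ξ)`. [folklore] -/
@[simp]
theorem unflattenCLM_apply (ψ : 𝓢(EuclideanSpace ℝ (Fin n × Fin (d + 1)), ℂ)) (ξ : Fin n → SpaceTime d) :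
    unflattenCLM d n ψ ξ = ψ (flattenCLE d n ξ) := rfl

/-- `flattenTest ∘ unflattenCLM = id`. [folklore] -/
@[simp]
theorem flattenTest_unflattenCLM (ψ : 𝓢(EuclideanSpace ℝ (Fin n × Fin (d + 1)), ℂ)) :
    flattenTest (unflattenCLM d n ψ) = ψ := by
  ext y; simp

/-- `unflattenCLM ∘ flattenTest = id`. [folklore] -/
@[simp]
theorem unflattenCLM_flattenTest (Φ : 𝓢((Fin n → SpaceTime d), ℂ)) :
    unflattenCLM d n (flattenTest Φ) = Φ := by
  ext x; simp

variable (d n) in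
/-- The flattened spectral set `flatten '' spectralSet d n ⊆ ℝ^{n(1+d)}`. [folklore] -/
abbrev flatSpectralSet : Set (EuclideanSpace ℝ (Fin n × Fin (d + 1))) := flattenCLE d n '' spectralSet d n

variable (d m) in
/-- The flattened OS momentum set `flatten '' osMomentumSet d m`. [folklore] -/
abbrev flatOsMomentumSet : Set (EuclideanSpace ℝ (Fin m × Fin (d + 1))) := flattenCLE d m '' osMomentumSet d m

/-- **The momentum-space distribution** `ũ = T ∘ 𝓕⁻¹` of an `n`-point tempered distribution `T`
on `(ℝ^{1+d})ⁿ`, read back on un-flattened test functions: `ũ Φ = (T ∘ unflatten ∘ 𝓕⁻¹)(flatten Φ)`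
(Osterwalder–Schrader I (1973), (4.12)–(4.13): the distribution `W̃ₙ` whose Fourier(–Laplace)
transform gives `𝔚ₙ` and `𝔖ₙ`). [cite: OsterwalderSchraderCMP1973, §4.1 eqs. (4.12)–(4.13)] -/
def momentumDual (T : 𝓢((Fin n → SpaceTime d), ℂ) →L[ℂ] ℂ) : 𝓢((Fin n → SpaceTime d), ℂ) →L[ℂ] ℂ :=
  (fourierInvDual (T.comp (unflattenCLM d n))).comp flattenTest

/-- `ũ (unflatten ψ) = (T ∘ unflatten ∘ 𝓕⁻¹)(ψ)`. [folklore] -/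
theorem momentumDual_unflattenCLM (T : 𝓢((Fin n → SpaceTime d), ℂ) →L[ℂ] ℂ)
    (ψ : 𝓢(EuclideanSpace ℝ (Fin n × Fin (d + 1)), ℂ)) :
    momentumDual T (unflattenCLM d n ψ) = fourierInvDual (T.comp (unflattenCLM d n)) ψ := by
  simp [momentumDual]

/-- **`T` in terms of `ũ`**: `T F = ũ (unflatten (𝓕 (flatten F)))`. [folklore] -/
theorem apply_eq_momentumDual_fourier (T : 𝓢((Fin n → SpaceTime d), ℂ) →L[ℂ] ℂ)
    (F : 𝓢((Fin n → SpaceTime d), ℂ)) :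
    T F = momentumDual T (unflattenCLM d n (𝓕 (flattenTest F))) := by
  rw [momentumDual_unflattenCLM, fourierInvDual_fourier, ContinuousLinearMap.comp_apply,
    unflattenCLM_flattenTest]

/-- The Fourier support hypothesis in flattened form. [folklore] -/
theorem fourierSupportedIn_flat {T : 𝓢((Fin n → SpaceTime d), ℂ) →L[ℂ] ℂ}
    (hT : FourierSupportedIn T (spectralSet d n)) (φ : 𝓢(EuclideanSpace ℝ (Fin n × Fin (d + 1)), ℂ))
    (hφ : Disjoint (tsupport (⇑(SchwartzMap.fourierTransformCLM ℂ φ))) (flatSpectralSet d n)) :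
    (T.comp (unflattenCLM d n)) φ = 0 := by
  have h := hT (unflattenCLM d n φ)
  rw [flattenTest_unflattenCLM] at h
  exact h hφ

/-- **The support property of `ũ`**: if two test functions agree on a neighbourhood of the
spectral set then `ũ` takes the same value on them (`ũ` is supported in the spectral set).
[folklore] -/
theorem momentumDual_eq_of_eqOn {T : 𝓢((Fin n → SpaceTime d), ℂ) →L[ℂ] ℂ}
    (hT : FourierSupportedIn T (spectralSet d n)) {Φ₁ Φ₂ : 𝓢((Fin n → SpaceTime d), ℂ)}
    {U : Set (Fin n → SpaceTime d)} (hU : IsOpen U) (hSU : spectralSet d n ⊆ U)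
    (h : EqOn Φ₁ Φ₂ U) : momentumDual T Φ₁ = momentumDual T Φ₂ := by
  rw [← sub_eq_zero, ← map_sub]
  change fourierInvDual (T.comp (unflattenCLM d n)) (flattenTest (Φ₁ - Φ₂)) = 0
  refine fourierInvDual_eq_zero (fourierSupportedIn_flat hT) ?_
  -- the support of the flattened difference misses the flattened spectral set
  have hsub : tsupport (⇑(flattenTest (Φ₁ - Φ₂))) ⊆ flattenCLE d n '' Uᶜ := by
    have hcomp : (⇑(flattenTest (Φ₁ - Φ₂)) : EuclideanSpace ℝ (Fin n × Fin (d + 1)) → ℂ) =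
        (⇑(Φ₁ - Φ₂)) ∘ (flattenCLE d n).symm := by
      funext y; rfl
    rw [hcomp]
    refine (tsupport_comp_subset_preimage _ (flattenCLE d n).symm.continuous).trans ?_
    intro y hy
    refine ⟨(flattenCLE d n).symm y, ?_, by simp⟩
    have hts : tsupport (⇑(Φ₁ - Φ₂)) ⊆ Uᶜ := by
      refine closure_minimal (fun x hx => ?_) hU.isClosed_compl
      intro hxU
      exact hx (by simp [h hxU])
    exact hts hy
  refine Set.disjoint_left.2 fun y hy hyS => ?_
  obtain ⟨x, hx, rfl⟩ := hsub hy
  obtain ⟨p, hp, hpx⟩ := hyS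
  have : p = x := (flattenCLE d n).injective hpx
  exact hx (hSU (this ▸ hp))

/-! ### The OS continuation is the Fourier–Laplace transform of `ũ` -/

section Continuation

variable {𝔚 : (Fin n → Fin (d + 1) → ℂ) → ℂ} {T : 𝓢((Fin n → SpaceTime d), ℂ) →L[ℂ] ℂ}

/-- **The OS continuation is the Fourier–Laplace transform of the momentum-space distribution**:
if `𝔚` is holomorphic on `𝒯ₙ` with distributional boundary value `T` and the Fourier transform of
`T` is supported in the spectral set, then `𝔚(z) = ũ(K_{z})` on `𝒯ₙ`, `K_z` the Fourier–Laplace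
kernel of the flattened spectral set (Osterwalder–Schrader I (1973), (4.12); Streater–Wightman
Thm. 3-5 with the uniqueness Thm. 2-17: both sides are holomorphic on `𝒯ₙ` with the same boundary
value). [cite: OsterwalderSchraderCMP1973, §4.1 eq. (4.12)] -/
theorem eqOn_fourierLaplaceFun (h𝔚 : DifferentiableOn ℂ 𝔚 (forwardTube d n))
    (hbv : HasDistributionalBoundaryValue 𝔚 T) (hT : FourierSupportedIn T (spectralSet d n)) :
    EqOn 𝔚 (fun z => fourierLaplaceFun (T.comp (unflattenCLM d n)) (flatSpectralSet d n)
      (configUncurry d n z)) (forwardTube d n) := by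
  set T' := T.comp (unflattenCLM d n) with hT'
  set 𝔚₂ : (Fin n → Fin (d + 1) → ℂ) → ℂ :=
    fun z => fourierLaplaceFun T' (flatSpectralSet d n) (configUncurry d n z) with h𝔚₂
  have h𝔚₂d : DifferentiableOn ℂ 𝔚₂ (forwardTube d n) := by
    refine (differentiableOn_fourierLaplaceFun T' (flatSpectralSet d n)).comp
      (configUncurry d n).differentiable.differentiableOn fun z hz => ?_
    show imVec (configUncurry d n z) ∈ interior (polarCone (flatSpectralSet d n))
    rw [show imVec (configUncurry d n z) =
      (WithLp.toLp 2 fun i => (configUncurry d n z i).im) from rfl, toLp_im_configUncurry]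
    exact flattenCLE_mem_interior_polarCone (tubeCone_subset_relTubeCone
      ((mem_forwardTube_iff_imPart_mem_tubeCone z).1 hz))
  have hbv₂ : HasDistributionalBoundaryValue 𝔚₂ T := by
    intro η hη G
    have hy := flattenCLE_mem_interior_polarCone (tubeCone_subset_relTubeCone hη)
    have hlim := tendsto_integral_fourierLaplaceFun_rayPoint_mul T' (flatSpectralSet d n)
      (fourierSupportedIn_flat hT) hy (flattenTest G)
    have hTG : T' (flattenTest G) = T G := by
      simp only [hT', ContinuousLinearMap.comp_apply, unflattenCLM_flattenTest]
    rw [hTG] at hlim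
    refine hlim.congr fun t => ?_
    rw [← integral_comp_flattenCLE]
    refine integral_congr_ae (Eventually.of_forall fun x => ?_)
    simp only [h𝔚₂, configUncurry_ray, flattenTest_apply, ContinuousLinearEquiv.symm_apply_apply]
  intro z hz
  have h := eq_zero_of_distributionalBoundaryValue_zero_holds (fun z => 𝔚 z - 𝔚₂ z)
    (h𝔚.sub h𝔚₂d) ?_ z hz
  · exact sub_eq_zero.1 h
  intro η hη F hF
  have t₁₂ := (hbv η hη F).sub (hbv₂ η hη F)
  rw [sub_self] at t₁₂
  refine t₁₂.congr' ?_
  filter_upwards [self_mem_nhdsWithin] with t ht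
  rw [← integral_sub (integrable_ray_mul h𝔚 hη ht hF) (integrable_ray_mul h𝔚₂d hη ht hF)]
  simp only [sub_mul]

/-- **The OS continuation at Euclidean points** is `ũ` of the kernel at `euclidUncurry x`, for
configurations with positive increasing times. [folklore] -/
theorem apply_euclideanPoint_eq (h𝔚 : DifferentiableOn ℂ 𝔚 (forwardTube d n))
    (hbv : HasDistributionalBoundaryValue 𝔚 T) (hT : FourierSupportedIn T (spectralSet d n))
    {x : Fin n → SpaceTime d} (hx : x ∈ timeOrderedRegion d n) :
    𝔚 (euclideanPoint x) = fourierInvDual (T.comp (unflattenCLM d n))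
      (laplaceKernel (flatSpectralSet d n) (euclidUncurry d n x)) := by
  rw [eqOn_fourierLaplaceFun h𝔚 hbv hT (euclideanPoint_mem_forwardTube hx.1 hx.2)]
  rfl

end Continuation

/-! ### The Laplace transforms of Euclidean test functions and the Euclidean formula -/

variable (d n) in
/-- **The Laplace transform of a Euclidean test function relative to the spectral set**,
`F̃ = unflatten (laplaceTest (flatten '' spectralSet) euclidUncurry F)` (Osterwalder–Schrader I
(1973), (4.20), for the full configuration). [cite: OsterwalderSchraderCMP1973, §4.3 eq. (4.20)] -/
def laplaceTestS (h : (Fin n → SpaceTime d) → ℂ) : 𝓢((Fin n → SpaceTime d), ℂ) :=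
  unflattenCLM d n (laplaceTest (flatSpectralSet d n) (euclidUncurry d n) volume h)

variable (d m) in
/-- **The Laplace transform of a positive-time Euclidean test function relative to the OS
momentum set** (Osterwalder–Schrader I (1973), (4.20), for one block `g̃ₘ`).
[cite: OsterwalderSchraderCMP1973, §4.3 eq. (4.20)] -/
def laplaceTestR (g : (Fin m → SpaceTime d) → ℂ) : 𝓢((Fin m → SpaceTime d), ℂ) :=
  unflattenCLM d m (laplaceTest (flatOsMomentumSet d m) (euclidUncurry d m) volume g)

/-- Pointwise formula: `F̃(ξ) = χ_S(flatten ξ) · rawLaplace F ξ` for `F` smooth and compactly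
supported in the increasing-time region. [folklore] -/
theorem laplaceTestS_apply {h : (Fin n → SpaceTime d) → ℂ} (hh : ContDiff ℝ ∞ h)
    (hc : HasCompactSupport h) (hsupp : tsupport h ⊆ monoRegion d n) (ξ : Fin n → SpaceTime d) :
    laplaceTestS d n h ξ = (coneCutoff (flatSpectralSet d n) (flattenCLE d n ξ) : ℂ) * rawLaplace d n h ξ := by
  rw [laplaceTestS, unflattenCLM_apply,
    laplaceTest_euclid_apply hh hc (hsupp.trans monoRegion_subset_laplaceDomain)]

/-- Pointwise formula: `g̃(ξ) = χ_R(flatten ξ) · rawLaplace g ξ` for `g` smooth and compactly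
supported in the positive time-ordered region. [folklore] -/
theorem laplaceTestR_apply {g : (Fin m → SpaceTime d) → ℂ} (hg : ContDiff ℝ ∞ g)
    (hc : HasCompactSupport g) (hsupp : tsupport g ⊆ timeOrderedRegion d m) (ξ : Fin m → SpaceTime d) :
    laplaceTestR d m g ξ = (coneCutoff (flatOsMomentumSet d m) (flattenCLE d m ξ) : ℂ) * rawLaplace d m g ξ := by
  rw [laplaceTestR, unflattenCLM_apply,
    laplaceTest_euclid_apply hg hc (hsupp.trans timeOrderedRegion_subset_laplaceDomain_os)]

/-- **The Euclidean formula in momentum space** (Osterwalder–Schrader I (1973), (4.12) integrated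
against a test function, (4.20)–(4.21)): if `𝔖ₙ(F) = ∫ 𝔚ₙ(ιx) F(x) dx` for time-ordered `F`, `𝔚ₙ`
being holomorphic on `𝒯ₙ` with boundary value `T` of spectral Fourier support, then for every
compactly supported smooth `F` supported in the positive time-ordered region
`𝔖ₙ(F) = ũ(F̃)`, `F̃ = laplaceTestS F`. [cite: OsterwalderSchraderCMP1973, §4.3 eqs. (4.20)–(4.21)] -/
theorem apply_eq_momentumDual_laplaceTestS {S : SchwingerFamily (EuclideanSpace ℝ (Fin (d + 1)))}
    {𝔚 : (Fin n → Fin (d + 1) → ℂ) → ℂ} {T : 𝓢((Fin n → SpaceTime d), ℂ) →L[ℂ] ℂ}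
    (h𝔚 : DifferentiableOn ℂ 𝔚 (forwardTube d n)) (hbv : HasDistributionalBoundaryValue 𝔚 T)
    (hT : FourierSupportedIn T (spectralSet d n))
    (hS : ∀ F : 𝓢((Fin n → EuclideanSpace ℝ (Fin (d + 1))), ℂ), IsTimeOrdered F →
      S n F = ∫ x, 𝔚 (euclideanPoint x) * F x)
    (F : 𝓢((Fin n → SpaceTime d), ℂ)) (hFc : HasCompactSupport (F : (Fin n → SpaceTime d) → ℂ))
    (hF : tsupport (F : (Fin n → SpaceTime d) → ℂ) ⊆ timeOrderedRegion d n) :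
    S n F = momentumDual T (laplaceTestS d n F) := by
  rw [hS F hF, laplaceTestS, momentumDual_unflattenCLM,
    clm_laplaceTest _ (F.smooth ⊤) hFc
      (hF.trans (timeOrderedRegion_subset_monoRegion.trans monoRegion_subset_laplaceDomain))]
  refine integral_congr_ae (Eventually.of_forall fun x => ?_)
  dsimp only
  by_cases hx : x ∈ tsupport (F : (Fin n → SpaceTime d) → ℂ)
  · rw [apply_euclideanPoint_eq h𝔚 hbv hT (hF hx), mul_comm]
  · simp [image_eq_zero_of_notMem_tsupport hx]

/-! ### Translation invariance in momentum space -/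

variable (d n) in
/-- The total momentum `P ξ = ∑ₖ ξₖ` of a momentum configuration. [folklore] -/
def totalMomentum : (Fin n → SpaceTime d) →L[ℝ] SpaceTime d :=
  ∑ k : Fin n, ContinuousLinearMap.proj (R := ℝ) (φ := fun _ : Fin n => SpaceTime d) k

/-- Pointwise formula. [folklore] -/
@[simp]
theorem totalMomentum_apply (ξ : Fin n → SpaceTime d) : totalMomentum d n ξ = ∑ k, ξ k := by
  simp [totalMomentum]

/-- `⟪flatten (a, …, a), flatten ξ⟫ = ⟪a, P ξ⟫`. [folklore] -/
theorem inner_flattenCLE_const (a : SpaceTime d) (ξ : Fin n → SpaceTime d) :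
    ⟪flattenCLE d n (fun _ : Fin n => a), flattenCLE d n ξ⟫ = ⟪a, totalMomentum d n ξ⟫ := by
  rw [inner_flattenCLE, totalMomentum_apply, inner_sum]

/-- Un-flattening a flattened translate is the translate: bookkeeping. [folklore] -/
theorem unflattenCLM_compSubConstCLM (a : SpaceTime d) (ψ : 𝓢(EuclideanSpace ℝ (Fin n × Fin (d + 1)), ℂ)) :
    unflattenCLM d n (SchwartzMap.compSubConstCLM ℂ (flattenCLE d n fun _ : Fin n => a) ψ) =
      translateMulti a (unflattenCLM d n ψ) := by
  ext x
  rw [unflattenCLM_apply, SchwartzMap.compSubConstCLM_apply, translateMulti_apply, unflattenCLM_apply,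
    ← map_sub]
  rfl

/-- **Translation invariance of `ũ` against Fourier phases**: if `T` is translation invariant then
`ũ (e^{−2πi⟪ã, ·⟫} Φ) = ũ Φ`, the phase-multiplied function being realised as
`unflatten (𝓕 (ψ(· − ã)))` for `ψ = 𝓕⁻¹ (flatten Φ)`. [folklore] -/
theorem momentumDual_unflattenCLM_fourier_compSubConstCLM {T : 𝓢((Fin n → SpaceTime d), ℂ) →L[ℂ] ℂ}
    (hTr : ∀ (a : SpaceTime d) (F : 𝓢((Fin n → SpaceTime d), ℂ)), T (translateMulti a F) = T F)
    (a : SpaceTime d) (ψ : 𝓢(EuclideanSpace ℝ (Fin n × Fin (d + 1)), ℂ)) :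
    momentumDual T (unflattenCLM d n (𝓕 (SchwartzMap.compSubConstCLM ℂ (flattenCLE d n fun _ : Fin n => a) ψ))) =
      momentumDual T (unflattenCLM d n (𝓕 ψ)) := by
  have h1 := apply_eq_momentumDual_fourier T
    (unflattenCLM d n (SchwartzMap.compSubConstCLM ℂ (flattenCLE d n fun _ : Fin n => a) ψ))
  have h2 := apply_eq_momentumDual_fourier T (unflattenCLM d n ψ)
  rw [flattenTest_unflattenCLM] at h1 h2
  rw [← h1, ← h2, unflattenCLM_compSubConstCLM, hTr]

/-- **Translation invariance in momentum space** (the dual form of `T(F(· − a)) = T(F)`): for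
every Schwartz function `γ` on `ℝ^{1+d}` and every test function `Φ`,
`ũ ((γ ∘ P) · Φ) = γ(0) ũ(Φ)`, `P` the total momentum. Proof: expand `γ = 𝓕β`, so that
`(γ ∘ P) Φ = ∫ β(a) e^{−2πi⟪ã, ·⟫} Φ da` is a Schwartz-valued integral of phase-multiplied
functions, on each of which `ũ` takes the value `ũ(Φ)`
(`momentumDual_unflattenCLM_fourier_compSubConstCLM`); the tempered distribution `ũ` commutes with
the integral (`SchwartzMap.apply_eq_integral_of_forall_apply_eq_integral`, with the continuity and
polynomial growth of translates from `SchwartzTranslationCutoff` / `SchwartzParametric`), and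
`∫ β = γ(0)`. [folklore] -/
theorem momentumDual_smulLeft_totalMomentum {T : 𝓢((Fin n → SpaceTime d), ℂ) →L[ℂ] ℂ}
    (hTr : ∀ (a : SpaceTime d) (F : 𝓢((Fin n → SpaceTime d), ℂ)), T (translateMulti a F) = T F)
    (γ : 𝓢(SpaceTime d, ℂ)) (Φ : 𝓢((Fin n → SpaceTime d), ℂ)) :
    momentumDual T (SchwartzMap.smulLeftCLM ℂ (fun ξ => γ (totalMomentum d n ξ)) Φ) =
      γ 0 * momentumDual T Φ := by
  -- the Fourier data
  set β : 𝓢(SpaceTime d, ℂ) := 𝓕⁻ γ with hβ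
  have hγ : 𝓕 β = γ := by rw [hβ]; exact FourierTransform.fourier_fourierInv_eq γ
  set ψ : 𝓢(EuclideanSpace ℝ (Fin n × Fin (d + 1)), ℂ) := 𝓕⁻ (flattenTest Φ) with hψ
  have hψΦ : 𝓕 ψ = flattenTest Φ := by rw [hψ]; exact FourierTransform.fourier_fourierInv_eq _
  have hΦ : unflattenCLM d n (𝓕 ψ) = Φ := by rw [hψΦ, unflattenCLM_flattenTest]
  -- the translation vector as a continuous linear map of `a`
  set L₀ : SpaceTime d →L[ℝ] EuclideanSpace ℝ (Fin n × Fin (d + 1)) :=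
    (flattenCLE d n).toContinuousLinearMap.comp
      (ContinuousLinearMap.pi fun _ : Fin n => ContinuousLinearMap.id ℝ (SpaceTime d)) with hL₀
  have hL₀a : ∀ a : SpaceTime d, L₀ a = flattenCLE d n (fun _ : Fin n => a) := fun a => rfl
  -- the Schwartz-valued family
  set Λ : 𝓢(EuclideanSpace ℝ (Fin n × Fin (d + 1)), ℂ) →L[ℂ] 𝓢((Fin n → SpaceTime d), ℂ) :=
    (unflattenCLM d n).comp (SchwartzMap.fourierTransformCLM ℂ) with hΛ
  set Ψ : SpaceTime d → 𝓢((Fin n → SpaceTime d), ℂ) :=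
    fun a => Λ (SchwartzMap.compSubConstCLM ℂ (L₀ a) ψ) with hΨ
  have hΨc : Continuous Ψ :=
    Λ.continuous.comp ((QuantumLattice.continuous_compSubConstCLM (𝕜 := ℂ) ψ).comp L₀.continuous)
  have hgrowth : ∀ k l : ℕ, ∃ (C : ℝ) (N : ℕ), ∀ a,
      SchwartzMap.seminorm ℂ k l (Ψ a) ≤ C * (1 + ‖a‖) ^ N := fun k l =>
    SchwartzMap.exists_seminorm_clm_compSubConstCLM_le Λ ψ L₀ k l
  -- `ũ` is constant on the family
  have hΨu : ∀ a, momentumDual T (Ψ a) = momentumDual T Φ := fun a => by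
    simp only [hΨ, hΛ, ContinuousLinearMap.comp_apply, SchwartzMap.fourierTransformCLM_apply, hL₀a]
    rw [momentumDual_unflattenCLM_fourier_compSubConstCLM hTr, hΦ]
  -- the pointwise formula
  have hK : ∀ ξ, SchwartzMap.smulLeftCLM ℂ (fun ξ => γ (totalMomentum d n ξ)) Φ ξ =
      ∫ a, β a * Ψ a ξ := fun ξ => by
    have hg : Function.HasTemperateGrowth fun ξ : Fin n → SpaceTime d => γ (totalMomentum d n ξ) :=
      γ.hasTemperateGrowth.comp (totalMomentum d n).hasTemperateGrowth
    rw [SchwartzMap.smulLeftCLM_apply_apply hg, smul_eq_mul]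
    have hΨξ : ∀ a, Ψ a ξ = (𝐞 (-⟪a, totalMomentum d n ξ⟫) : ℂ) * Φ ξ := fun a => by
      simp only [hΨ, hΛ, ContinuousLinearMap.comp_apply, SchwartzMap.fourierTransformCLM_apply,
        unflattenCLM_apply, hL₀a]
      rw [WightmanFamily.fourier_compSubConstCLM_apply, inner_flattenCLE_const, hψΦ, flattenTest_apply,
        ContinuousLinearEquiv.symm_apply_apply]
    simp_rw [hΨξ, ← mul_assoc]
    rw [integral_mul_const, ← hγ, SchwartzMap.fourier_coe, Real.fourier_eq]
    congr 1
    refine integral_congr_ae (Eventually.of_forall fun a => ?_)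
    simp only [Circle.smul_def, smul_eq_mul, mul_comm]
  rw [SchwartzMap.apply_eq_integral_of_forall_apply_eq_integral (momentumDual T) Ψ hΨc hgrowth β
    β.continuous (fun N => β.integrable_one_add_norm_pow_mul N) _ hK]
  simp_rw [hΨu]
  rw [integral_mul_const, ← hγ, SchwartzMap.fourier_coe, Real.fourier_eq]
  congr 1
  refine integral_congr_ae (Eventually.of_forall fun a => ?_)
  simp

/-! ### The Euclidean formula for test functions with increasing times of any sign -/

section AnySign

variable {S : SchwingerFamily (EuclideanSpace ℝ (Fin (d + 1)))}
  {𝔚 : (Fin n → Fin (d + 1) → ℂ) → ℂ} {T : 𝓢((Fin n → SpaceTime d), ℂ) →L[ℂ] ℂ}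

/-- The total momentum is bounded on the support of the cutoff of the spectral set (where the
total momentum vanishes): `χ_S(flatten ξ) ≠ 0 ⟹ ‖P ξ‖ ≤ 3 ‖P ∘ flatten⁻¹‖`. [folklore] -/
theorem norm_totalMomentum_le_of_coneCutoff_ne_zero {ξ : Fin n → SpaceTime d}
    (hξ : coneCutoff (flatSpectralSet d n) (flattenCLE d n ξ) ≠ 0) :
    ‖totalMomentum d n ξ‖ ≤
      3 * ‖(totalMomentum d n).comp ((flattenCLE d n).symm : EuclideanSpace ℝ (Fin n × Fin (d + 1)) →L[ℝ] (Fin n → SpaceTime d))‖ := by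
  set Pf := (totalMomentum d n).comp
    ((flattenCLE d n).symm : EuclideanSpace ℝ (Fin n × Fin (d + 1)) →L[ℝ] (Fin n → SpaceTime d)) with hPf
  have hmem : flattenCLE d n ξ ∈ Metric.thickening 3 (flatSpectralSet d n) :=
    tsupport_coneCutoff_subset _ (subset_tsupport _ hξ)
  rw [Metric.mem_thickening_iff] at hmem
  obtain ⟨_, ⟨p, hp, rfl⟩, hdist⟩ := hmem
  have hPp : totalMomentum d n p = 0 := by rw [totalMomentum_apply]; exact hp.1
  have hdiff : totalMomentum d n ξ = Pf (flattenCLE d n ξ - flattenCLE d n p) := by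
    rw [hPf, ContinuousLinearMap.comp_apply, map_sub]
    simp only [ContinuousLinearEquiv.coe_coe, ContinuousLinearEquiv.symm_apply_apply, map_sub, hPp, sub_zero]
  rw [hdiff]
  refine (Pf.le_opNorm _).trans ?_
  rw [mul_comm]
  refine mul_le_mul_of_nonneg_right ?_ (norm_nonneg _)
  rw [← dist_eq_norm]; exact hdist.le

/-- The smooth compactly supported function `p ↦ b(p) e^{2πt p⁰}`, `b` a bump equal to `1` on the
closed ball of radius `C`. [folklore] -/
def expBumpFun (t C : ℝ) (hC : 0 < C) : SpaceTime d → ℂ := fun p =>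
  ((⟨C, C + 1, hC, by linarith⟩ : ContDiffBump (0 : SpaceTime d)) p : ℂ) *
    exp ((2 * Real.pi * t * p 0 : ℝ) : ℂ)

/-- `expBumpFun` is smooth. [folklore] -/
theorem contDiff_expBumpFun (t C : ℝ) (hC : 0 < C) : ContDiff ℝ ∞ (expBumpFun (d := d) t C hC) := by
  have hc0 : ContDiff ℝ ∞ fun p : SpaceTime d => p 0 :=
    (EuclideanSpace.proj (𝕜 := ℝ) (0 : Fin (d + 1))).contDiff
  refine (Complex.ofRealCLM.contDiff.comp (ContDiffBump.contDiff _)).mul (Complex.contDiff_exp.comp ?_)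
  exact Complex.ofRealCLM.contDiff.comp (contDiff_const.mul hc0)

/-- `expBumpFun` has compact support (in the closed ball of radius `C + 1`). [folklore] -/
theorem hasCompactSupport_expBumpFun (t C : ℝ) (hC : 0 < C) :
    HasCompactSupport (expBumpFun (d := d) t C hC) := by
  refine HasCompactSupport.intro (isCompact_closedBall (0 : SpaceTime d) (C + 1)) fun p hp => ?_
  have hb : ((⟨C, C + 1, hC, by linarith⟩ : ContDiffBump (0 : SpaceTime d)) p) = 0 := by
    refine ContDiffBump.zero_of_le_dist _ ?_
    rw [Metric.mem_closedBall] at hp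
    exact (not_le.1 hp).le
  simp [expBumpFun, hb]

/-- A Schwartz function on `ℝ^{1+d}` equal to `p ↦ e^{2πt p⁰}` on the closed ball of radius `C`
(a smooth bump times the exponential). [folklore] -/
theorem exists_schwartz_eq_exp_on_ball (t C : ℝ) (hC : 0 < C) :
    ∃ γ : 𝓢(SpaceTime d, ℂ), γ 0 = 1 ∧ ∀ p : SpaceTime d, ‖p‖ ≤ C →
      γ p = exp ((2 * Real.pi * t * p 0 : ℝ) : ℂ) := by
  refine ⟨(hasCompactSupport_expBumpFun t C hC).toSchwartzMap (contDiff_expBumpFun t C hC), ?_,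
    fun p hp => ?_⟩
  · show expBumpFun t C hC 0 = 1
    have hb : ((⟨C, C + 1, hC, by linarith⟩ : ContDiffBump (0 : SpaceTime d)) 0) = 1 :=
      ContDiffBump.one_of_mem_closedBall _ (Metric.mem_closedBall_self hC.le)
    simp [expBumpFun, hb]
  · show expBumpFun t C hC p = _
    have hb : ((⟨C, C + 1, hC, by linarith⟩ : ContDiffBump (0 : SpaceTime d)) p) = 1 :=
      ContDiffBump.one_of_mem_closedBall _ (by simpa using hp)
    rw [expBumpFun]
    dsimp only
    rw [hb, Complex.ofReal_one, one_mul]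

/-- **Time shifts of the Laplace transform**: `(F(· − tê₀))̃ = (γ_t ∘ P) · F̃` for a Schwartz `γ_t`
equal to `e^{2πt p⁰}` on the (bounded) set of total momenta met on the support of the cutoff.
[folklore] -/
theorem laplaceTestS_translateMulti_single (F : 𝓢((Fin n → SpaceTime d), ℂ))
    (hFc : HasCompactSupport (F : (Fin n → SpaceTime d) → ℂ))
    (hF : tsupport (F : (Fin n → SpaceTime d) → ℂ) ⊆ monoRegion d n) (t : ℝ)
    (hFtc : HasCompactSupport (translateMulti (EuclideanSpace.single 0 t) F : (Fin n → SpaceTime d) → ℂ))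
    (hFt : tsupport (translateMulti (EuclideanSpace.single 0 t) F : (Fin n → SpaceTime d) → ℂ) ⊆ monoRegion d n) :
    ∃ γ : 𝓢(SpaceTime d, ℂ), γ 0 = 1 ∧
      laplaceTestS d n (translateMulti (EuclideanSpace.single 0 t) F) =
        SchwartzMap.smulLeftCLM ℂ (fun ξ => γ (totalMomentum d n ξ)) (laplaceTestS d n F) := by
  set C : ℝ := 3 * ‖(totalMomentum d n).comp
    ((flattenCLE d n).symm : EuclideanSpace ℝ (Fin n × Fin (d + 1)) →L[ℝ] (Fin n → SpaceTime d))‖ + 1 with hC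
  obtain ⟨γ, hγ0, hγ⟩ := exists_schwartz_eq_exp_on_ball (d := d) t C (by positivity)
  refine ⟨γ, hγ0, ?_⟩
  have hg : Function.HasTemperateGrowth fun ξ : Fin n → SpaceTime d => γ (totalMomentum d n ξ) :=
    γ.hasTemperateGrowth.comp (totalMomentum d n).hasTemperateGrowth
  ext ξ
  rw [SchwartzMap.smulLeftCLM_apply_apply hg, smul_eq_mul,
    laplaceTestS_apply ((translateMulti _ F).smooth ⊤) hFtc hFt,
    laplaceTestS_apply (F.smooth ⊤) hFc hF]
  have htr : ((translateMulti (EuclideanSpace.single 0 t) F : 𝓢((Fin n → SpaceTime d), ℂ)) :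
      (Fin n → SpaceTime d) → ℂ) = fun x => F fun k => x k - EuclideanSpace.single 0 t := by
    funext x; exact translateMulti_apply _ F x
  rw [htr, rawLaplace_translate_single]
  by_cases hχ : coneCutoff (flatSpectralSet d n) (flattenCLE d n ξ) = 0
  · simp [hχ]
  · have hP : ‖totalMomentum d n ξ‖ ≤ C := (norm_totalMomentum_le_of_coneCutoff_ne_zero hχ).trans (by
      rw [hC]; linarith)
    rw [hγ _ hP, totalMomentum_apply]
    have : (∑ k, ξ k) 0 = ∑ k, ξ k 0 := by simp [Finset.sum_apply]
    rw [this]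
    ring

/-- Translating a test function: compact support is preserved. [folklore] -/
theorem hasCompactSupport_translateMulti {a : SpaceTime d} {F : 𝓢((Fin n → SpaceTime d), ℂ)}
    (hFc : HasCompactSupport (F : (Fin n → SpaceTime d) → ℂ)) :
    HasCompactSupport (translateMulti a F : (Fin n → SpaceTime d) → ℂ) := by
  have h : ((translateMulti a F : 𝓢((Fin n → SpaceTime d), ℂ)) : (Fin n → SpaceTime d) → ℂ) =
      (F : (Fin n → SpaceTime d) → ℂ) ∘ (Homeomorph.addRight (-(fun _ : Fin n => a))) := by
    funext x
    rw [translateMulti_apply]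
    simp [sub_eq_add_neg]
    rfl
  rw [h]
  exact hFc.comp_homeomorph _

/-- Translating a test function: the support moves along. [folklore] -/
theorem tsupport_translateMulti_subset (a : SpaceTime d) (F : 𝓢((Fin n → SpaceTime d), ℂ)) :
    tsupport (translateMulti a F : (Fin n → SpaceTime d) → ℂ) ⊆
      {x | (fun k => x k - a) ∈ tsupport (F : (Fin n → SpaceTime d) → ℂ)} := by
  have h : ((translateMulti a F : 𝓢((Fin n → SpaceTime d), ℂ)) : (Fin n → SpaceTime d) → ℂ) =
      (F : (Fin n → SpaceTime d) → ℂ) ∘ fun x k => x k - a := by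
    funext x; exact translateMulti_apply a F x
  rw [h]
  exact tsupport_comp_subset_preimage _ (by fun_prop)

/-- **The Euclidean formula for compactly supported test functions with increasing times of any
sign**: `𝔖ₙ(F) = ũ(F̃)`. Reduction to positive times by a time translation (E1), under which the
Laplace transform is multiplied by the Schwartz multiplier `γ_t ∘ P` with `γ_t(0) = 1`
(`laplaceTestS_translateMulti_single`), invisible to `ũ` (`momentumDual_smulLeft_totalMomentum`).
[cite: OsterwalderSchraderCMP1973, §4.3 eqs. (4.20)–(4.22)] -/
theorem apply_eq_momentumDual_laplaceTestS_of_monoRegion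
    (hSt : ∀ (t : ℝ) (F : 𝓢((Fin n → SpaceTime d), ℂ)), S n (translateMulti (EuclideanSpace.single 0 t) F) = S n F)
    (h𝔚 : DifferentiableOn ℂ 𝔚 (forwardTube d n)) (hbv : HasDistributionalBoundaryValue 𝔚 T)
    (hT : FourierSupportedIn T (spectralSet d n))
    (hTr : ∀ (a : SpaceTime d) (F : 𝓢((Fin n → SpaceTime d), ℂ)), T (translateMulti a F) = T F)
    (hS : ∀ F : 𝓢((Fin n → EuclideanSpace ℝ (Fin (d + 1))), ℂ), IsTimeOrdered F →
      S n F = ∫ x, 𝔚 (euclideanPoint x) * F x)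
    (F : 𝓢((Fin n → SpaceTime d), ℂ)) (hFc : HasCompactSupport (F : (Fin n → SpaceTime d) → ℂ))
    (hF : tsupport (F : (Fin n → SpaceTime d) → ℂ) ⊆ monoRegion d n) :
    S n F = momentumDual T (laplaceTestS d n F) := by
  -- a time shift making all times positive
  obtain ⟨R, hR⟩ := hFc.isCompact.isBounded.subset_closedBall 0
  set t : ℝ := |R| + 1 with ht
  set Ft := translateMulti (EuclideanSpace.single (0 : Fin (d + 1)) t) F with hFt
  have hFtc : HasCompactSupport (Ft : (Fin n → SpaceTime d) → ℂ) := hasCompactSupport_translateMulti hFc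
  have hFt_ord : tsupport (Ft : (Fin n → SpaceTime d) → ℂ) ⊆ timeOrderedRegion d n := by
    intro x hx
    have hy := tsupport_translateMulti_subset _ F hx
    simp only [mem_setOf_eq] at hy
    have hyF := hF hy
    have hyR : (fun k => x k - EuclideanSpace.single (0 : Fin (d + 1)) t) ∈ Metric.closedBall 0 R := hR hy
    rw [mem_closedBall_zero_iff] at hyR
    have htime : ∀ k, x k 0 = (x k - EuclideanSpace.single (0 : Fin (d + 1)) t) 0 + t := fun k => by simp
    refine ⟨fun k => ?_, fun i j hij => ?_⟩
    · rw [htime k]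
      have h1 : |(x k - EuclideanSpace.single (0 : Fin (d + 1)) t) 0| ≤ R := by
        refine le_trans ?_ ((norm_le_pi_norm _ k).trans hyR)
        simpa [Real.norm_eq_abs] using PiLp.norm_apply_le (x k - EuclideanSpace.single (0 : Fin (d + 1)) t) 0
      have h2 := neg_abs_le ((x k - EuclideanSpace.single (0 : Fin (d + 1)) t) 0)
      rw [ht]
      linarith [le_abs_self R]
    · have h := hyF hij
      simp only [PiLp.sub_apply, PiLp.single_apply, if_true] at h
      linarith
  have hFt_mono : tsupport (Ft : (Fin n → SpaceTime d) → ℂ) ⊆ monoRegion d n :=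
    hFt_ord.trans timeOrderedRegion_subset_monoRegion
  obtain ⟨γ, hγ0, hγ⟩ := laplaceTestS_translateMulti_single F hFc hF t hFtc hFt_mono
  rw [← hSt t F, apply_eq_momentumDual_laplaceTestS h𝔚 hbv hT hS Ft hFtc hFt_ord]
  have hγ' : laplaceTestS d n (Ft : (Fin n → SpaceTime d) → ℂ) =
      SchwartzMap.smulLeftCLM ℂ (fun ξ => γ (totalMomentum d n ξ)) (laplaceTestS d n F) := by
    rw [hFt]; exact hγ
  rw [hγ', momentumDual_smulLeft_totalMomentum hTr, hγ0, one_mul]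

end AnySign

/-! ### The OS inner product in momentum space -/

section Gram

variable {S : SchwingerFamily (EuclideanSpace ℝ (Fin (d + 1)))}
  {𝔚 : (Fin (n + m) → Fin (d + 1) → ℂ) → ℂ} {T : 𝓢((Fin (n + m) → SpaceTime d), ℂ) →L[ℂ] ℂ}

/-- Compact support of the OS adjoint of a compactly supported test function. [folklore] -/
theorem _root_.HasCompactSupport.osAdjoint {f : 𝓢((Fin n → SpaceTime d), ℂ)}
    (hfc : HasCompactSupport (f : (Fin n → SpaceTime d) → ℂ)) :
    HasCompactSupport (QuantumLattice.osAdjoint f : (Fin n → SpaceTime d) → ℂ) := by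
  have hc : Continuous fun x : Fin n → SpaceTime d => fun k => timeReflection (d + 1) (x (Fin.rev k)) :=
    continuous_pi fun k => (timeReflection (d + 1)).continuous.comp (continuous_apply _)
  have himage : HasCompactSupport ((f : (Fin n → SpaceTime d) → ℂ) ∘
      fun x : Fin n → SpaceTime d => fun k => timeReflection (d + 1) (x (Fin.rev k))) := by
    refine HasCompactSupport.intro' ((hfc.isCompact.image hc)) ((hfc.isCompact.image hc).isClosed)
      fun x hx => ?_
    by_contra hne
    refine hx ⟨fun k => timeReflection (d + 1) (x (Fin.rev k)), subset_tsupport _ hne, ?_⟩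
    funext k
    simp [timeReflection_timeReflection]
  have h : ((QuantumLattice.osAdjoint f : 𝓢((Fin n → SpaceTime d), ℂ)) : (Fin n → SpaceTime d) → ℂ) =
      fun x => conj (((f : (Fin n → SpaceTime d) → ℂ) ∘
        fun x : Fin n → SpaceTime d => fun k => timeReflection (d + 1) (x (Fin.rev k))) x) := by
    funext x; exact QuantumLattice.osAdjoint_apply f x
  rw [h]
  exact himage.comp_left (by simp)

/-- The test function `ΘF* ⊗ G` of an OS inner product as a bare function. [folklore] -/
theorem coe_appendTensor_osAdjoint (f : 𝓢((Fin n → SpaceTime d), ℂ)) (g : 𝓢((Fin m → SpaceTime d), ℂ)) :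
    ((SchwartzMap.appendTensor (osAdjoint f) g : 𝓢((Fin (n + m) → SpaceTime d), ℂ)) :
      (Fin (n + m) → SpaceTime d) → ℂ) = fun z =>
      conj (f fun k => timeReflection (d + 1) (z (Fin.castAdd m (Fin.rev k)))) *
        g (fun j => z (Fin.natAdd n j)) := by
  funext z
  rw [SchwartzMap.appendTensor_apply, osAdjoint_apply]
  rfl

/-- **The OS inner product in momentum space** (Osterwalder–Schrader I (1973), (4.22)–(4.23)): for
test functions `f`, `g` compactly supported in the positive time-ordered regions,
`𝔖ₙ₊ₘ(Θf* ⊗ g) = ũₙ₊ₘ((Θf* ⊗ g)̃)`. [cite: OsterwalderSchraderCMP1973, §4.3 eqs. (4.22)–(4.23)] -/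
theorem osPairing_eq_momentumDual [NeZero d] (hE1 : S.IsEuclideanCovariant)
    (h𝔚 : DifferentiableOn ℂ 𝔚 (forwardTube d (n + m))) (hbv : HasDistributionalBoundaryValue 𝔚 T)
    (hT : FourierSupportedIn T (spectralSet d (n + m)))
    (hTr : ∀ (a : SpaceTime d) (F : 𝓢((Fin (n + m) → SpaceTime d), ℂ)), T (translateMulti a F) = T F)
    (hS : ∀ F : 𝓢((Fin (n + m) → EuclideanSpace ℝ (Fin (d + 1))), ℂ), IsTimeOrdered F →
      S (n + m) F = ∫ x, 𝔚 (euclideanPoint x) * F x)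
    {f : 𝓢((Fin n → SpaceTime d), ℂ)} (hfc : HasCompactSupport (f : (Fin n → SpaceTime d) → ℂ))
    (hf : tsupport (f : (Fin n → SpaceTime d) → ℂ) ⊆ timeOrderedRegion d n)
    {g : 𝓢((Fin m → SpaceTime d), ℂ)} (hgc : HasCompactSupport (g : (Fin m → SpaceTime d) → ℂ))
    (hg : tsupport (g : (Fin m → SpaceTime d) → ℂ) ⊆ timeOrderedRegion d m) :
    S.osPairing f g = momentumDual T (laplaceTestS d (n + m) (SchwartzMap.appendTensor (osAdjoint f) g)) := by
  have hHc : HasCompactSupport ((SchwartzMap.appendTensor (osAdjoint f) g :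
      𝓢((Fin (n + m) → SpaceTime d), ℂ)) : (Fin (n + m) → SpaceTime d) → ℂ) := by
    have h := hasCompactSupport_appendMul hfc.osAdjoint hgc
    exact h
  have hH : tsupport ((SchwartzMap.appendTensor (osAdjoint f) g :
      𝓢((Fin (n + m) → SpaceTime d), ℂ)) : (Fin (n + m) → SpaceTime d) → ℂ) ⊆ monoRegion d (n + m) := by
    rw [coe_appendTensor_osAdjoint]
    exact tsupport_osAdjoint_appendMul_subset_monoRegion hf hg
  exact apply_eq_momentumDual_laplaceTestS_of_monoRegion (fun t F => hE1.translateMulti _ _ F)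
    h𝔚 hbv hT hTr hS _ hHc hH

/-- **The Laplace transform of `ΘF* ⊗ G`** (Osterwalder–Schrader I (1973), (4.24)):
`(ΘF* ⊗ G)̃(ξ) = χ_S(ξ̃) · conj F̃⁰(−ξ_{n−1}, …, −ξ₀) · G̃⁰(ξ_n, …, ξ_{n+m−1})` with the raw
transforms `F̃⁰ = rawLaplace F`, `G̃⁰ = rawLaplace G`. [cite: OsterwalderSchraderCMP1973, §4.3 eq. (4.24)] -/
theorem laplaceTestS_appendTensor_osAdjoint_apply [NeZero d] {f : 𝓢((Fin n → SpaceTime d), ℂ)}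
    (hfc : HasCompactSupport (f : (Fin n → SpaceTime d) → ℂ))
    (hf : tsupport (f : (Fin n → SpaceTime d) → ℂ) ⊆ timeOrderedRegion d n)
    {g : 𝓢((Fin m → SpaceTime d), ℂ)} (hgc : HasCompactSupport (g : (Fin m → SpaceTime d) → ℂ))
    (hg : tsupport (g : (Fin m → SpaceTime d) → ℂ) ⊆ timeOrderedRegion d m) (ξ : Fin (n + m) → SpaceTime d) :
    laplaceTestS d (n + m) (SchwartzMap.appendTensor (osAdjoint f) g) ξ =
      (coneCutoff (flatSpectralSet d (n + m)) (flattenCLE d (n + m) ξ) : ℂ) *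
        (conj (rawLaplace d n f (negRevConfig d n fun i => ξ (Fin.castAdd m i))) *
          rawLaplace d m g (fun j => ξ (Fin.natAdd n j))) := by
  have hHc : HasCompactSupport ((SchwartzMap.appendTensor (osAdjoint f) g :
      𝓢((Fin (n + m) → SpaceTime d), ℂ)) : (Fin (n + m) → SpaceTime d) → ℂ) :=
    hasCompactSupport_appendMul hfc.osAdjoint hgc
  have hH : tsupport ((SchwartzMap.appendTensor (osAdjoint f) g :
      𝓢((Fin (n + m) → SpaceTime d), ℂ)) : (Fin (n + m) → SpaceTime d) → ℂ) ⊆ monoRegion d (n + m) := by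
    rw [coe_appendTensor_osAdjoint]
    exact tsupport_osAdjoint_appendMul_subset_monoRegion hf hg
  rw [laplaceTestS_apply ((SchwartzMap.appendTensor (osAdjoint f) g).smooth ⊤) hHc hH,
    coe_appendTensor_osAdjoint]
  congr 1
  have h := rawLaplace_append (d := d)
    (fun x : Fin n → SpaceTime d => conj (f fun k => timeReflection (d + 1) (x (Fin.rev k))))
    (g : (Fin m → SpaceTime d) → ℂ) ξ
  rw [rawLaplace_osAdjoint] at h
  exact h

variable (d n) in
/-- The reflection `φ ↦ (ξ ↦ conj φ(−ξ_{n−1}, …, −ξ₀))` of momentum-space test functions (the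
form in which the transform of an OS adjoint appears, OS I (1973), (4.24), `f̄̃ₙ(qₙ, −q_{n−1}, …)`),
a conjugate-linear homeomorphism of `𝓢((ℝ^{1+d})ⁿ)`. [cite: OsterwalderSchraderCMP1973, §4.3 eq. (4.24)] -/
def starNegRev : 𝓢((Fin n → SpaceTime d), ℂ) →L[ℝ] 𝓢((Fin n → SpaceTime d), ℂ) :=
  (starTest : 𝓢((Fin n → SpaceTime d), ℂ) →L[ℝ] 𝓢((Fin n → SpaceTime d), ℂ)).comp
    ((SchwartzMap.compCLMOfContinuousLinearEquiv ℂ (negRevConfig d n)).restrictScalars ℝ)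

/-- Pointwise formula. [folklore] -/
@[simp]
theorem starNegRev_apply (φ : 𝓢((Fin n → SpaceTime d), ℂ)) (ξ : Fin n → SpaceTime d) :
    starNegRev d n φ ξ = conj (φ (negRevConfig d n ξ)) := rfl

variable (d) in
/-- Multiplication by the cutoff `χ_S ∘ flatten` of the spectral set of `N` points, a continuous
linear map of `𝓢((ℝ^{1+d})ᴺ)` (temperate growth of the cutoff). [folklore] -/
def cutoffS (N : ℕ) : 𝓢((Fin N → SpaceTime d), ℂ) →L[ℂ] 𝓢((Fin N → SpaceTime d), ℂ) :=
  SchwartzMap.smulLeftCLM ℂ fun ξ => (coneCutoff (flatSpectralSet d N) (flattenCLE d N ξ) : ℂ)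

/-- The cutoff multiplier has temperate growth. [folklore] -/
theorem hasTemperateGrowth_cutoffS (N : ℕ) :
    Function.HasTemperateGrowth fun ξ : Fin N → SpaceTime d =>
      (coneCutoff (flatSpectralSet d N) (flattenCLE d N ξ) : ℂ) :=
  (hasTemperateGrowth_coneCutoff (flatSpectralSet d N)).comp (flattenCLE d N).toContinuousLinearMap.hasTemperateGrowth

/-- Pointwise formula. [folklore] -/
@[simp]
theorem cutoffS_apply (N : ℕ) (Φ : 𝓢((Fin N → SpaceTime d), ℂ)) (ξ : Fin N → SpaceTime d) :
    cutoffS d N Φ ξ = (coneCutoff (flatSpectralSet d N) (flattenCLE d N ξ) : ℂ) * Φ ξ := by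
  rw [cutoffS, SchwartzMap.smulLeftCLM_apply_apply (hasTemperateGrowth_cutoffS N), smul_eq_mul]

/-- **The OS inner product through the block transforms** (Osterwalder–Schrader I (1973),
(4.24)–(4.25)): for `f`, `g` compactly supported in the positive time-ordered regions,
`𝔖ₙ₊ₘ(Θf* ⊗ g) = ũₙ₊ₘ(χ_S · (starNegRev f̃ ⊗ g̃))` with the Laplace transforms `f̃ = laplaceTestR f`,
`g̃ = laplaceTestR g` relative to the OS momentum sets — the two Schwartz functions
`(Θf* ⊗ g)̃` and `χ_S · (starNegRev f̃ ⊗ g̃)` agree near the spectral set (block structure,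
`OSLaplaceGeometry`), which is all `ũ` sees. [cite: OsterwalderSchraderCMP1973, §4.3 eqs. (4.24)–(4.25)] -/
theorem osPairing_eq_momentumDual_blocks [NeZero d] (hE1 : S.IsEuclideanCovariant)
    (h𝔚 : DifferentiableOn ℂ 𝔚 (forwardTube d (n + m))) (hbv : HasDistributionalBoundaryValue 𝔚 T)
    (hT : FourierSupportedIn T (spectralSet d (n + m)))
    (hTr : ∀ (a : SpaceTime d) (F : 𝓢((Fin (n + m) → SpaceTime d), ℂ)), T (translateMulti a F) = T F)
    (hS : ∀ F : 𝓢((Fin (n + m) → EuclideanSpace ℝ (Fin (d + 1))), ℂ), IsTimeOrdered F →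
      S (n + m) F = ∫ x, 𝔚 (euclideanPoint x) * F x)
    {f : 𝓢((Fin n → SpaceTime d), ℂ)} (hfc : HasCompactSupport (f : (Fin n → SpaceTime d) → ℂ))
    (hf : tsupport (f : (Fin n → SpaceTime d) → ℂ) ⊆ timeOrderedRegion d n)
    {g : 𝓢((Fin m → SpaceTime d), ℂ)} (hgc : HasCompactSupport (g : (Fin m → SpaceTime d) → ℂ))
    (hg : tsupport (g : (Fin m → SpaceTime d) → ℂ) ⊆ timeOrderedRegion d m) :
    S.osPairing f g = momentumDual T (cutoffS d (n + m)
      (SchwartzMap.appendTensor (starNegRev d n (laplaceTestR d n f)) (laplaceTestR d m g))) := by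
  rw [osPairing_eq_momentumDual hE1 h𝔚 hbv hT hTr hS hfc hf hgc hg]
  -- the neighbourhood of the spectral set on which the two test functions agree
  set U : Set (Fin (n + m) → SpaceTime d) :=
    {ξ | flattenCLE d n (negRevConfig d n fun i => ξ (Fin.castAdd m i)) ∈
        Metric.thickening 1 (flatOsMomentumSet d n) ∧
      flattenCLE d m (fun j => ξ (Fin.natAdd n j)) ∈ Metric.thickening 1 (flatOsMomentumSet d m)} with hU
  have hUo : IsOpen U := by
    have h1 : Continuous fun ξ : Fin (n + m) → SpaceTime d =>
        flattenCLE d n (negRevConfig d n fun i => ξ (Fin.castAdd m i)) :=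
      (flattenCLE d n).continuous.comp ((negRevConfig d n).continuous.comp
        (continuous_pi fun i => continuous_apply _))
    have h2 : Continuous fun ξ : Fin (n + m) → SpaceTime d => flattenCLE d m fun j => ξ (Fin.natAdd n j) :=
      (flattenCLE d m).continuous.comp (continuous_pi fun j => continuous_apply _)
    exact (Metric.isOpen_thickening.preimage h1).inter (Metric.isOpen_thickening.preimage h2)
  have hSU : spectralSet d (n + m) ⊆ U := fun p hp =>
    ⟨Metric.self_subset_thickening one_pos _ ⟨_, negRev_block_castAdd_mem_osMomentumSet hp, rfl⟩,
      Metric.self_subset_thickening one_pos _ ⟨_, block_natAdd_mem_osMomentumSet hp, rfl⟩⟩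
  refine momentumDual_eq_of_eqOn hT hUo hSU fun ξ hξ => ?_
  have h1 : coneCutoff (flatOsMomentumSet d n) (flattenCLE d n (negRevConfig d n (ξ ∘ Fin.castAdd m))) = 1 :=
    coneCutoff_eq_one hξ.1
  have h2 : coneCutoff (flatOsMomentumSet d m) (flattenCLE d m (ξ ∘ Fin.natAdd n)) = 1 :=
    coneCutoff_eq_one hξ.2
  rw [laplaceTestS_appendTensor_osAdjoint_apply hfc hf hgc hg, cutoffS_apply, SchwartzMap.appendTensor_apply,
    starNegRev_apply, laplaceTestR_apply (f.smooth ⊤) hfc hf, laplaceTestR_apply (g.smooth ⊤) hgc hg,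
    h1, h2]
  simp only [Complex.ofReal_one, one_mul]
  rfl

end Gram

end Literature.MathematicalPhysics.QuantumFieldTheory
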